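import Mathlib
import Summits.Ventures.PercRepro2.Graph

/-!
# The root-only pocket at `b`, part 1: the dead-end structure (blind cell PercRepro2, p4 g16;
S3 (G4-u) item (ac); pure combinatorics, no definitions)

A **pocket** `P ⊆ V` at the mark `b` (`b ∈ P`) is *root-only* for the roots `u, a₂ ∉ P` of the smaller
instance when every edge touching `P` has both endpoints in `P ∪ {a₂, u}` (`hP`).  A configuration `ω`
is split into an **outside part** `off ω` (the pocket edges — those touching `P` — closed, the other
edges as in `ω`; `hoff`) and a **pocket part** `inn ω` (the other edges closed; `hinn`); the two maps
are parameters characterised by these two properties, so that no definition is needed.  Whenever the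
pocket part does not connect `u` to `a₂`:

* **`conn_off_of_conn`** (the closure theorem): for `x ∉ P`, everything `x` reaches is, if outside `P`,
  reached in the outside part; and a pocket vertex `y` is reached through `a₂` (outside `x ↔ a₂`, then a
  pocket path `a₂ ↔ y`) or through `u`;
* **`conn_iff_off`**: for `x, y ∉ P`, `x ↔ y` iff `x ↔ y` in the outside part;
* **`conn_b_iff`**: for `x ∉ P`, `y ∈ P`, `x ↔ y` iff `(x ↔ a₂ outside ∧ a₂ ↔ y in the pocket)` or the
  same through `u`;
* **`conn_u_a₂_iff`**: `u ↔ a₂` iff `u ↔ a₂` in the pocket part or in the outside part;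
* **`conn_a₂_b_iff_inn` / `conn_u_b_iff_inn`**: on `{u ↮ a₂}`, `b ∈ K` iff the pocket part joins `a₂`
  to `b`, and `b ∈ L` iff it joins `u` to `b`.

The coin class of RootLeafUCoinGraph is the pocket `P = {b}`; here a pocket may hold any number of
unmarked vertices and any edges among `P ∪ {a₂, u}` touching `P`.
-/

namespace Summit.Ventures.PercRepro2

namespace RootLeafU

namespace Pocket

variable {V : Type*} {E : Type*}

section Parts

variable {ends : E → Sym2 V} {P : Set V} {off inn : Config E → Config E}

/-- The outside part is below `ω`. -/
lemma off_le (hoff : (∀ ω e, e ∈ touches ends P → off ω e = false) ∧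
    (∀ ω e, e ∉ touches ends P → off ω e = ω e)) (ω : Config E) : off ω ≤ ω := by
  intro e
  by_cases he : e ∈ touches ends P
  · rw [hoff.1 ω e he]; exact Bool.false_le _
  · rw [hoff.2 ω e he]

/-- The pocket part is below `ω`. -/
lemma inn_le (hinn : (∀ ω e, e ∈ touches ends P → inn ω e = ω e) ∧
    (∀ ω e, e ∉ touches ends P → inn ω e = false)) (ω : Config E) : inn ω ≤ ω := by
  intro e
  by_cases he : e ∈ touches ends P
  · rw [hinn.1 ω e he]
  · rw [hinn.2 ω e he]; exact Bool.false_le _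

/-- The outside part only depends on the non-pocket edges. -/
lemma off_eq_of_eqOn (hoff : (∀ ω e, e ∈ touches ends P → off ω e = false) ∧
    (∀ ω e, e ∉ touches ends P → off ω e = ω e)) {ω ω' : Config E}
    (h : ∀ e, e ∉ touches ends P → ω e = ω' e) : off ω = off ω' := by
  funext e
  by_cases he : e ∈ touches ends P
  · rw [hoff.1 ω e he, hoff.1 ω' e he]
  · rw [hoff.2 ω e he, hoff.2 ω' e he, h e he]

/-- The pocket part only depends on the pocket edges. -/
lemma inn_eq_of_eqOn (hinn : (∀ ω e, e ∈ touches ends P → inn ω e = ω e) ∧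
    (∀ ω e, e ∉ touches ends P → inn ω e = false)) {ω ω' : Config E}
    (h : ∀ e, e ∈ touches ends P → ω e = ω' e) : inn ω = inn ω' := by
  funext e
  by_cases he : e ∈ touches ends P
  · rw [hinn.1 ω e he, hinn.1 ω' e he, h e he]
  · rw [hinn.2 ω e he, hinn.2 ω' e he]

/-- An edge between two vertices outside `P` is not a pocket edge. -/
lemma notMem_touches_of_ends {e : E} {y z : V} (hy : y ∉ P) (hz : z ∉ P) (hends : ends e = s(y, z)) :
    e ∉ touches ends P := by
  intro he
  obtain ⟨x, hx, y', hxy⟩ := mem_touches.1 he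
  rw [hends, Sym2.eq_iff] at hxy
  rcases hxy with ⟨h1, _⟩ | ⟨_, h2⟩
  · exact hy (h1 ▸ hx)
  · exact hz (h2 ▸ hx)

/-- Open adjacency between two vertices outside `P` survives in the outside part. -/
lemma openAdj_off_of_openAdj (hoff : (∀ ω e, e ∈ touches ends P → off ω e = false) ∧
    (∀ ω e, e ∉ touches ends P → off ω e = ω e)) {ω : Config E} {y z : V} (hy : y ∉ P) (hz : z ∉ P)
    (h : OpenAdj ends ω y z) : OpenAdj ends (off ω) y z := by
  obtain ⟨e, he, hends⟩ := h
  exact ⟨e, by rw [hoff.2 ω e (notMem_touches_of_ends hy hz hends), he], hends⟩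

/-- Open adjacency from a pocket vertex survives in the pocket part. -/
lemma openAdj_inn_of_openAdj (hinn : (∀ ω e, e ∈ touches ends P → inn ω e = ω e) ∧
    (∀ ω e, e ∉ touches ends P → inn ω e = false)) {ω : Config E} {y z : V} (hy : y ∈ P)
    (h : OpenAdj ends ω y z) : OpenAdj ends (inn ω) y z := by
  obtain ⟨e, he, hends⟩ := h
  exact ⟨e, by rw [hinn.1 ω e (mem_touches_of_ends hends (Or.inl hy)), he], hends⟩

end Parts

section DeadEnd

variable {ends : E → Sym2 V} {P : Set V} {a₂ u : V} {off inn : Config E → Config E}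

/-- The other endpoint of an open edge at a pocket vertex lies in `P ∪ {a₂, u}`. -/
lemma mem_or_of_openAdj (hP : ∀ e y z, ends e = s(y, z) → y ∈ P → z ∈ P ∨ z = a₂ ∨ z = u)
    {ω : Config E} {y z : V} (hy : y ∈ P) (h : OpenAdj ends ω y z) : z ∈ P ∨ z = a₂ ∨ z = u := by
  obtain ⟨e, _, hends⟩ := h
  exact hP e y z hends hy

/-- **The closure theorem**: when the pocket part does not join `u` to `a₂`, everything reached from
`x ∉ P` is reached in the outside part if it lies outside `P`, and through `a₂` or through `u` (outside
to the root, then inside the pocket) if it lies in `P`. -/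
theorem conn_off_of_conn (hP : ∀ e y z, ends e = s(y, z) → y ∈ P → z ∈ P ∨ z = a₂ ∨ z = u)
    (hoff : (∀ ω e, e ∈ touches ends P → off ω e = false) ∧ (∀ ω e, e ∉ touches ends P → off ω e = ω e))
    (hinn : (∀ ω e, e ∈ touches ends P → inn ω e = ω e) ∧ (∀ ω e, e ∉ touches ends P → inn ω e = false))
    {ω : Config E} (hQ : ¬ Conn ends (inn ω) u a₂) {x : V} (hx : x ∉ P) {y : V}
    (h : Conn ends ω x y) :
    (y ∉ P → Conn ends (off ω) x y) ∧
      (y ∈ P → (Conn ends (off ω) x a₂ ∧ Conn ends (inn ω) a₂ y) ∨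
        (Conn ends (off ω) x u ∧ Conn ends (inn ω) u y)) := by
  let S : Set V := {y | (y ∉ P → Conn ends (off ω) x y) ∧
      (y ∈ P → (Conn ends (off ω) x a₂ ∧ Conn ends (inn ω) a₂ y) ∨
        (Conn ends (off ω) x u ∧ Conn ends (inn ω) u y))}
  have hxS : x ∈ S := ⟨fun _ => conn_refl _ _ _, fun hxP => absurd hxP hx⟩
  have hS : ∀ y ∈ S, ∀ z, (openGraph ends ω).Adj y z → z ∈ S := by
    intro y hy z hyz
    obtain ⟨_, hadj⟩ := openGraph_adj.1 hyz
    by_cases hyP : y ∈ P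
    · -- `y` in the pocket: the edge survives in the pocket part
      have hin : Conn ends (inn ω) y z := conn_of_openAdj (openAdj_inn_of_openAdj hinn hyP hadj)
      rcases hy.2 hyP with ⟨hxa, hay⟩ | ⟨hxu, huy⟩
      · -- reached through `a₂`
        have haz : Conn ends (inn ω) a₂ z := conn_trans hay hin
        refine ⟨fun hzP => ?_, fun _ => Or.inl ⟨hxa, haz⟩⟩
        rcases mem_or_of_openAdj hP hyP hadj with h | rfl | rfl
        · exact absurd h hzP
        · exact hxa
        · exact absurd (conn_symm haz) hQ
      · -- reached through `u`
        have huz : Conn ends (inn ω) u z := conn_trans huy hin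
        refine ⟨fun hzP => ?_, fun _ => Or.inr ⟨hxu, huz⟩⟩
        rcases mem_or_of_openAdj hP hyP hadj with h | rfl | rfl
        · exact absurd h hzP
        · exact absurd huz hQ
        · exact hxu
    · -- `y` outside the pocket
      have hxy : Conn ends (off ω) x y := hy.1 hyP
      by_cases hzP : z ∈ P
      · -- the edge enters the pocket: `y` is a root
        have hin : Conn ends (inn ω) y z :=
          conn_symm (conn_of_openAdj (openAdj_inn_of_openAdj hinn hzP hadj.symm))
        rcases mem_or_of_openAdj hP hzP hadj.symm with h | rfl | rfl
        · exact absurd h hyP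
        · exact ⟨fun h => absurd hzP h, fun _ => Or.inl ⟨hxy, hin⟩⟩
        · exact ⟨fun h => absurd hzP h, fun _ => Or.inr ⟨hxy, hin⟩⟩
      · -- both outside: the edge survives in the outside part
        have := openAdj_off_of_openAdj hoff hyP hzP hadj
        exact ⟨fun _ => conn_trans hxy (conn_of_openAdj this), fun h => absurd h hzP⟩
  exact mem_of_conn_of_closed hS hxS h

/-- For `x, y ∉ P` (pocket part not joining `u` to `a₂`): `x ↔ y` iff `x ↔ y` in the outside part. -/
theorem conn_iff_off (hP : ∀ e y z, ends e = s(y, z) → y ∈ P → z ∈ P ∨ z = a₂ ∨ z = u)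
    (hoff : (∀ ω e, e ∈ touches ends P → off ω e = false) ∧ (∀ ω e, e ∉ touches ends P → off ω e = ω e))
    (hinn : (∀ ω e, e ∈ touches ends P → inn ω e = ω e) ∧ (∀ ω e, e ∉ touches ends P → inn ω e = false))
    {ω : Config E} (hQ : ¬ Conn ends (inn ω) u a₂) {x y : V} (hx : x ∉ P) (hy : y ∉ P) :
    Conn ends ω x y ↔ Conn ends (off ω) x y :=
  ⟨fun h => (conn_off_of_conn hP hoff hinn hQ hx h).1 hy, fun h => conn_mono (off_le hoff ω) h⟩

/-- For `x ∉ P`, `y ∈ P` (pocket part not joining `u` to `a₂`): `x ↔ y` iff `x` reaches a root in the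
outside part and the root reaches `y` in the pocket part. -/
theorem conn_b_iff (hP : ∀ e y z, ends e = s(y, z) → y ∈ P → z ∈ P ∨ z = a₂ ∨ z = u)
    (hoff : (∀ ω e, e ∈ touches ends P → off ω e = false) ∧ (∀ ω e, e ∉ touches ends P → off ω e = ω e))
    (hinn : (∀ ω e, e ∈ touches ends P → inn ω e = ω e) ∧ (∀ ω e, e ∉ touches ends P → inn ω e = false))
    {ω : Config E} (hQ : ¬ Conn ends (inn ω) u a₂) {x y : V} (hx : x ∉ P) (hy : y ∈ P) :
    Conn ends ω x y ↔
      (Conn ends (off ω) x a₂ ∧ Conn ends (inn ω) a₂ y) ∨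
        (Conn ends (off ω) x u ∧ Conn ends (inn ω) u y) := by
  constructor
  · intro h
    exact (conn_off_of_conn hP hoff hinn hQ hx h).2 hy
  · rintro (⟨h1, h2⟩ | ⟨h1, h2⟩)
    · exact conn_trans (conn_mono (off_le hoff ω) h1) (conn_mono (inn_le hinn ω) h2)
    · exact conn_trans (conn_mono (off_le hoff ω) h1) (conn_mono (inn_le hinn ω) h2)

/-- `u ↔ a₂` iff the pocket part or the outside part joins them. -/
theorem conn_u_a₂_iff (hP : ∀ e y z, ends e = s(y, z) → y ∈ P → z ∈ P ∨ z = a₂ ∨ z = u)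
    (hoff : (∀ ω e, e ∈ touches ends P → off ω e = false) ∧ (∀ ω e, e ∉ touches ends P → off ω e = ω e))
    (hinn : (∀ ω e, e ∈ touches ends P → inn ω e = ω e) ∧ (∀ ω e, e ∉ touches ends P → inn ω e = false))
    (hu : u ∉ P) (ha : a₂ ∉ P) (ω : Config E) :
    Conn ends ω u a₂ ↔ Conn ends (inn ω) u a₂ ∨ Conn ends (off ω) u a₂ := by
  constructor
  · intro h
    by_cases hQ : Conn ends (inn ω) u a₂
    · exact Or.inl hQ
    · exact Or.inr ((conn_iff_off hP hoff hinn hQ hu ha).1 h)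
  · rintro (h | h)
    · exact conn_mono (inn_le hinn ω) h
    · exact conn_mono (off_le hoff ω) h

/-- On `{u ↮ a₂}`, the pocket part does not join `u` to `a₂`. -/
lemma not_conn_inn_of_not_conn
    (hinn : (∀ ω e, e ∈ touches ends P → inn ω e = ω e) ∧ (∀ ω e, e ∉ touches ends P → inn ω e = false))
    {ω : Config E} (h : ¬ Conn ends ω u a₂) : ¬ Conn ends (inn ω) u a₂ :=
  fun h' => h (conn_mono (inn_le hinn ω) h')

/-- On `{u ↮ a₂}`, a pocket vertex `y` is in the cluster of `a₂` iff the pocket part joins `a₂` to `y`. -/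
theorem conn_a₂_b_iff_inn (hP : ∀ e y z, ends e = s(y, z) → y ∈ P → z ∈ P ∨ z = a₂ ∨ z = u)
    (hoff : (∀ ω e, e ∈ touches ends P → off ω e = false) ∧ (∀ ω e, e ∉ touches ends P → off ω e = ω e))
    (hinn : (∀ ω e, e ∈ touches ends P → inn ω e = ω e) ∧ (∀ ω e, e ∉ touches ends P → inn ω e = false))
    (ha : a₂ ∉ P) {ω : Config E} (h : ¬ Conn ends ω u a₂) {y : V} (hy : y ∈ P) :
    Conn ends ω a₂ y ↔ Conn ends (inn ω) a₂ y := by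
  have hQ := not_conn_inn_of_not_conn hinn h
  rw [conn_b_iff hP hoff hinn hQ ha hy]
  constructor
  · rintro (⟨_, h2⟩ | ⟨h1, _⟩)
    · exact h2
    · exact absurd (conn_symm (conn_mono (off_le hoff ω) h1)) h
  · intro h2
    exact Or.inl ⟨conn_refl _ _ _, h2⟩

/-- On `{u ↮ a₂}`, a pocket vertex `y` is in the cluster of `u` iff the pocket part joins `u` to `y`. -/
theorem conn_u_b_iff_inn (hP : ∀ e y z, ends e = s(y, z) → y ∈ P → z ∈ P ∨ z = a₂ ∨ z = u)
    (hoff : (∀ ω e, e ∈ touches ends P → off ω e = false) ∧ (∀ ω e, e ∉ touches ends P → off ω e = ω e))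
    (hinn : (∀ ω e, e ∈ touches ends P → inn ω e = ω e) ∧ (∀ ω e, e ∉ touches ends P → inn ω e = false))
    (hu : u ∉ P) {ω : Config E} (h : ¬ Conn ends ω u a₂) {y : V} (hy : y ∈ P) :
    Conn ends ω u y ↔ Conn ends (inn ω) u y := by
  have hQ := not_conn_inn_of_not_conn hinn h
  rw [conn_b_iff hP hoff hinn hQ hu hy]
  constructor
  · rintro (⟨h1, _⟩ | ⟨_, h2⟩)
    · exact absurd (conn_mono (off_le hoff ω) h1) h
    · exact h2
  · intro h2
    exact Or.inr ⟨conn_refl _ _ _, h2⟩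

end DeadEnd

end Pocket

end RootLeafU

end Summit.Ventures.PercRepro2
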